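import Summits.HubbardSuperconductivity.HubbardSuperconductivity.Theorems.BcsKacWindowCoherenceWindowLROGroundStateTransfer
import Literature.MathematicalPhysics.QuantumLattice.FreeFermiGasNoThermalPairFieldLRO

/-!
# Route `BcsKacWindow`, crux `CoherenceWindowLRO` — the low-energy-subspace interface is LOSSLESS

Third helper file of the every-sector-ground-state step for the crux item
`stmt-HubbardSuperconductivity-1319` (`CoherenceWindowLRO`, rank 2 of route `BcsKacWindow`), line
`birth`. The companion file `BcsKacWindowCoherenceWindowLROGroundStateTransfer` proves
`coherenceWindowLRO_of_lowEnergySubspaces`: the crux follows from low-energy-subspace data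
`(W, γ, ε, α)` on the window tori (gap `γ` above the sector energy on `K ∩ W^⊥`, coupling `ε`,
`d`-wave order `α ≥ 4c₀Δ(U)²L⁴` on `W`, `16ε² ≤ γ²`, `256L⁴ε² ≤ αγ²`). Here the converse:

* `lowEnergySubspaces_of_coherenceWindowLRO` — **necessity**: `CoherenceWindowLRO` implies that
  data, with `W :=` the sector ground multiplet `K ⊓ ker(H - e)`, `ε := 0`, `γ :=` the spectral gap
  of `H` above `e` inside the sector (`exists_gap_above_groundMultiplet`, which is `> 0` on every
  finite torus), and `α := c₀Δ(U)²L⁴` (the crux at every vector of the multiplet, by homogeneity);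
  the constant of the data is `c₀/4`;
* `coherenceWindowLRO_iff_lowEnergySubspaces` — hence the interface is an EQUIVALENT reformulation
  of the crux: "`CoherenceWindowLRO` ⟺ every window torus sector carries a gapped, weakly coupled
  low-energy subspace with `d`-wave pair order at the BCS rate".

Reading. The equivalence says the parallelogram interface loses nothing — and, equally, that it
cannot be easier than the crux: its content is entirely in producing `W` with QUANTITATIVE `γ, ε`
(the sharp interfaces of `BcsKacWindowCoherenceWindowLROSharpTransfer`, which add the
approximate-eigenvector bound `‖Δ_d†Δ_d w‖ ≤ (α+β)‖w‖`, are not known to be implied by the crux).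
Folklore finite-dimensional linear algebra; no definition and no named fact is introduced.
Tree API: `exists_gap_above_groundMultiplet`, `mem_inf_eigenspace_toLin'_iff`,
`hubbardTorus_mulVec_mem_szSector`, `exists_normalize`, `PairFieldYang.expect_smul_vec_eq`.
-/

set_option linter.dupNamespace false

namespace Summit.HubbardSuperconductivity.HubbardSuperconductivity.Theorems.BcsKacWindow

open Matrix Literature.MathematicalPhysics.QuantumLattice
open Literature.MathematicalPhysics.QuantumLattice.EigenvalueContinuation
open Summit.HubbardSuperconductivity.HubbardSuperconductivity.Theses.BcsKacWindow
open scoped ComplexOrder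

/-- **Necessity of the low-energy-subspace data.** `CoherenceWindowLRO` implies the hypothesis of
`coherenceWindowLRO_of_lowEnergySubspaces` (same `a, b, κ₁, κ₂, s₀, Δ, U₁(s)`, constant `c₀/4`):
on each window torus take `W := K ⊓ ker(H - e)` the ground multiplet of the sector
`K = szSector N 0` (`e = minEnergyOn H K`), `ε := 0` (`⟨q, H w⟩ = e⟨q, w⟩ = 0` for `q ⊥ W`),
`γ :=` the gap of `H|_K` above `e` (`exists_gap_above_groundMultiplet`; the sector is `H`-invariant
by `hubbardTorus_mulVec_mem_szSector`), and `α := c₀Δ(U)²L⁴` — every nonzero vector of the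
multiplet is, after normalisation, a sector ground state to which the crux applies. [folklore] -/
theorem lowEnergySubspaces_of_coherenceWindowLRO : CoherenceWindowLRO →
    (∃ (a b κ₁ κ₂ c₀ s₀ : ℝ) (Δ : ℝ → ℝ), 0 < a ∧ a < b ∧ b < 1 / 2 ∧ 0 < κ₁ ∧ κ₁ ≤ κ₂ ∧
      0 < c₀ ∧ 0 < s₀ ∧
      (∀ U : ℝ, 0 < U → Real.exp (-(κ₂ / U ^ 2)) ≤ Δ U ∧ Δ U ≤ Real.exp (-(κ₁ / U ^ 2))) ∧
      ∀ s : ℝ, s₀ ≤ s → ∃ U₁ : ℝ, 0 < U₁ ∧ ∀ δ ∈ Set.Icc a b, ∀ U ∈ Set.Ioo (0 : ℝ) U₁,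
        ∀ (L : ℕ) [NeZero L], Even L → s₀ ≤ Δ U * L → Δ U * L ≤ s →
          ∃ (W : Submodule ℂ (Fock (Orb (FermionTorus 2 L)))) (γ ε α : ℝ),
            W ≤ szSector (2 * ⌊(1 - δ) * (L : ℝ) ^ 2 / 2⌋₊) 0 ∧ 0 < γ ∧ 0 ≤ ε ∧
            16 * ε ^ 2 ≤ γ ^ 2 ∧ 256 * (L : ℝ) ^ 4 * ε ^ 2 ≤ α * γ ^ 2 ∧
            4 * c₀ * Δ U ^ 2 * (L : ℝ) ^ 4 ≤ α ∧
            (∀ q ∈ szSector (2 * ⌊(1 - δ) * (L : ℝ) ^ 2 / 2⌋₊) 0, (∀ w ∈ W, star w ⬝ᵥ q = 0) →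
              ((hubbardTorus 2 L 1 U).minEnergyOn (szSector (2 * ⌊(1 - δ) * (L : ℝ) ^ 2 / 2⌋₊) 0)
                  + γ) * (star q ⬝ᵥ q).re ≤ (star q ⬝ᵥ hubbardTorus 2 L 1 U *ᵥ q).re) ∧
            (∀ q ∈ szSector (2 * ⌊(1 - δ) * (L : ℝ) ^ 2 / 2⌋₊) 0, (∀ w ∈ W, star w ⬝ᵥ q = 0) →
              ∀ w ∈ W, ‖star q ⬝ᵥ hubbardTorus 2 L 1 U *ᵥ w‖ ≤ ε * (eucNorm q * eucNorm w)) ∧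
            (∀ w ∈ W, α * (star w ⬝ᵥ w).re ≤
              (star w ⬝ᵥ ((pairField dWaveFormFactor L)ᴴ * pairField dWaveFormFactor L) *ᵥ w).re)) := by
  intro h
  obtain ⟨a, b, κ₁, κ₂, c₀, s₀, Δ, ha, hab, hb, hκ₁, hκ₁₂, hc₀, hs₀, hpin, hS⟩ := h
  refine ⟨a, b, κ₁, κ₂, c₀ / 4, s₀, Δ, ha, hab, hb, hκ₁, hκ₁₂, by positivity, hs₀, hpin,
    fun s hs => ?_⟩
  obtain ⟨U₁, hU₁, hwin⟩ := hS s hs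
  clear hS
  refine ⟨U₁, hU₁, ?_⟩
  intro δ hδ U hU L _ hE hlo hhi
  have hcrux := hwin δ hδ U hU L hE hlo hhi
  clear hwin
  -- the sector, its energy, its ground multiplet and the gap above it
  have hHh : (hubbardTorus 2 L 1 U).IsHermitian :=
    hubbardTorus_isHermitian (hamiltonian_isHermitian_and_commute_holds _) 1 U
  have hKinv : ∀ v ∈ szSector (Λ := FermionTorus 2 L) (2 * ⌊(1 - δ) * (L : ℝ) ^ 2 / 2⌋₊) 0,
      hubbardTorus 2 L 1 U *ᵥ v ∈ szSector (Λ := FermionTorus 2 L) (2 * ⌊(1 - δ) * (L : ℝ) ^ 2 / 2⌋₊) 0 :=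
    fun v hv => hubbardTorus_mulVec_mem_szSector 1 U hv
  obtain ⟨g, hg, hgap⟩ := exists_gap_above_groundMultiplet hHh _ hKinv
  have hΔpos : 0 < Δ U := lt_of_lt_of_le (Real.exp_pos _) (hpin U hU.1).1
  have hLpos : (0 : ℝ) < (L : ℝ) := Nat.cast_pos.mpr (Nat.pos_of_ne_zero (NeZero.ne L))
  refine ⟨szSector (2 * ⌊(1 - δ) * (L : ℝ) ^ 2 / 2⌋₊) 0 ⊓ Module.End.eigenspace
      (Matrix.toLin' (hubbardTorus 2 L 1 U))
      (((hubbardTorus 2 L 1 U).minEnergyOn (szSector (2 * ⌊(1 - δ) * (L : ℝ) ^ 2 / 2⌋₊) 0) : ℝ) : ℂ),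
    g, 0, c₀ * Δ U ^ 2 * (L : ℝ) ^ 4, inf_le_left, hg, le_rfl, ?_, ?_, ?_, ?_, ?_, ?_⟩
  · -- `16 · 0² ≤ g²`
    have : (0 : ℝ) ≤ g ^ 2 := by positivity
    simpa using this
  · -- `256 L⁴ · 0² ≤ α g²`
    have : (0 : ℝ) ≤ c₀ * Δ U ^ 2 * (L : ℝ) ^ 4 * g ^ 2 := by positivity
    simpa using this
  · -- `4 (c₀/4) Δ² L⁴ ≤ c₀ Δ² L⁴`
    linarith
  · -- the gap on `K ∩ W^⊥`
    intro q hq horth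
    refine hgap q hq fun ψ hψK hψ => horth ψ ?_
    exact (mem_inf_eigenspace_toLin'_iff _ _ _ ψ).2 ⟨hψK, hψ⟩
  · -- no coupling: `⟨q, H w⟩ = e ⟨q, w⟩ = 0`
    intro q _ horth w hw
    obtain ⟨-, hHw⟩ := (mem_inf_eigenspace_toLin'_iff _ _ _ w).1 hw
    have hqw : star q ⬝ᵥ w = 0 := by rw [star_dotProduct, horth w hw, star_zero]
    rw [hHw, dotProduct_smul, hqw, smul_zero, norm_zero, zero_mul]
  · -- the order on the multiplet: the crux at the normalised vector
    intro w hw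
    by_cases hw0 : w = 0
    · subst hw0
      simp
    obtain ⟨hwK, hHw⟩ := (mem_inf_eigenspace_toLin'_iff _ _ _ w).1 hw
    obtain ⟨c, hc, hcc, hc1⟩ := exists_normalize hw0
    have hgs : IsGroundStateInSector (hubbardTorus 2 L 1 U) (2 * ⌊(1 - δ) * (L : ℝ) ^ 2 / 2⌋₊) 0
        ((c : ℂ) • w) := by
      refine ⟨Submodule.smul_mem _ _ hwK, ?_, ?_⟩
      · exact smul_ne_zero (by exact_mod_cast hc.ne') hw0
      · rw [mulVec_smul, hHw, smul_comm]
    have hc' := hcrux ((c : ℂ) • w) hc1 hgs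
    have hL4 : (0 : ℝ) < (L : ℝ) ^ 4 := by positivity
    rw [le_div_iff₀ hL4, PairFieldYang.expect_smul_vec_eq] at hc'
    -- `star c * c = c²` (real `c`), and `c² ‖w‖² = 1`
    have hsc : (star (c : ℂ) * (c : ℂ)) = ((c * c : ℝ) : ℂ) := by
      rw [Complex.star_def, Complex.conj_ofReal]
      push_cast
      ring
    rw [hsc, Complex.re_ofReal_mul] at hc'
    simp only [expect] at hc'
    -- multiply the target by `c² > 0`
    have hcc0 : 0 < c * c := mul_pos hc hc
    have key : c * c * (c₀ * Δ U ^ 2 * (L : ℝ) ^ 4 * (star w ⬝ᵥ w).re) ≤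
        c * c * (star w ⬝ᵥ ((pairField dWaveFormFactor L)ᴴ * pairField dWaveFormFactor L) *ᵥ w).re := by
      calc c * c * (c₀ * Δ U ^ 2 * (L : ℝ) ^ 4 * (star w ⬝ᵥ w).re)
          = c₀ * Δ U ^ 2 * (L : ℝ) ^ 4 * (c * c * (star w ⬝ᵥ w).re) := by ring
        _ = c₀ * Δ U ^ 2 * (L : ℝ) ^ 4 := by rw [hcc, mul_one]
        _ ≤ _ := hc'
    exact le_of_mul_le_mul_left key hcc0

/-- **`CoherenceWindowLRO` ⟺ low-energy-subspace data on the window tori.** The conjunction of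
`coherenceWindowLRO_of_lowEnergySubspaces` (sufficiency, the Kato transfer with Yang's ceiling) and
`lowEnergySubspaces_of_coherenceWindowLRO` (necessity, the ground multiplet itself): the crux is
EQUIVALENT to "in the coherence window every `(N, S^z=0)` sector of `hubbardTorus 2 L 1 U` carries a
subspace `W` gapped by `γ` from the rest of the sector, coupled to it by `ε` with `16ε² ≤ γ²`,
`256L⁴ε² ≤ αγ²`, and carrying `d_{x²-y²}` pair order `α ≥ 4c₀Δ(U)²L⁴`". [folklore] -/
theorem coherenceWindowLRO_iff_lowEnergySubspaces : CoherenceWindowLRO ↔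
    (∃ (a b κ₁ κ₂ c₀ s₀ : ℝ) (Δ : ℝ → ℝ), 0 < a ∧ a < b ∧ b < 1 / 2 ∧ 0 < κ₁ ∧ κ₁ ≤ κ₂ ∧
      0 < c₀ ∧ 0 < s₀ ∧
      (∀ U : ℝ, 0 < U → Real.exp (-(κ₂ / U ^ 2)) ≤ Δ U ∧ Δ U ≤ Real.exp (-(κ₁ / U ^ 2))) ∧
      ∀ s : ℝ, s₀ ≤ s → ∃ U₁ : ℝ, 0 < U₁ ∧ ∀ δ ∈ Set.Icc a b, ∀ U ∈ Set.Ioo (0 : ℝ) U₁,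
        ∀ (L : ℕ) [NeZero L], Even L → s₀ ≤ Δ U * L → Δ U * L ≤ s →
          ∃ (W : Submodule ℂ (Fock (Orb (FermionTorus 2 L)))) (γ ε α : ℝ),
            W ≤ szSector (2 * ⌊(1 - δ) * (L : ℝ) ^ 2 / 2⌋₊) 0 ∧ 0 < γ ∧ 0 ≤ ε ∧
            16 * ε ^ 2 ≤ γ ^ 2 ∧ 256 * (L : ℝ) ^ 4 * ε ^ 2 ≤ α * γ ^ 2 ∧
            4 * c₀ * Δ U ^ 2 * (L : ℝ) ^ 4 ≤ α ∧
            (∀ q ∈ szSector (2 * ⌊(1 - δ) * (L : ℝ) ^ 2 / 2⌋₊) 0, (∀ w ∈ W, star w ⬝ᵥ q = 0) →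
              ((hubbardTorus 2 L 1 U).minEnergyOn (szSector (2 * ⌊(1 - δ) * (L : ℝ) ^ 2 / 2⌋₊) 0)
                  + γ) * (star q ⬝ᵥ q).re ≤ (star q ⬝ᵥ hubbardTorus 2 L 1 U *ᵥ q).re) ∧
            (∀ q ∈ szSector (2 * ⌊(1 - δ) * (L : ℝ) ^ 2 / 2⌋₊) 0, (∀ w ∈ W, star w ⬝ᵥ q = 0) →
              ∀ w ∈ W, ‖star q ⬝ᵥ hubbardTorus 2 L 1 U *ᵥ w‖ ≤ ε * (eucNorm q * eucNorm w)) ∧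
            (∀ w ∈ W, α * (star w ⬝ᵥ w).re ≤
              (star w ⬝ᵥ ((pairField dWaveFormFactor L)ᴴ * pairField dWaveFormFactor L) *ᵥ w).re)) :=
  ⟨lowEnergySubspaces_of_coherenceWindowLRO, coherenceWindowLRO_of_lowEnergySubspaces⟩

end Summit.HubbardSuperconductivity.HubbardSuperconductivity.Theorems.BcsKacWindow
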